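import Summits.ABC.ABC.Theorems.CongruentialReceptacleBalancedFreySzpiroStubFreyModelSqLe
import HarnessLib

/-!
# Crux `BalancedFreySzpiro` (stmt-ABC-1723), line SketchIdeator1: the hard stub's hypotheses

Load-bearing analysis of the hard stub `stub_szpiroMinimalModel` of the picked line (Szpiro's
`|Δ(W₀)| ≤ C(ε) · N^(6+ε)` for integral Weierstrass models `W₀/ℤ`, elliptic over `ℚ` and minimal at
every prime), by the standing disprover (refuter-cdisprove-stmt-ABC-1723-0):

* `stubSzpiroMinimalModel_false_without_minimality` — MINIMALITY is load-bearing: without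
  `∀ v, IsMinimalAt v` the rescaled models `y² = x³ − u⁴x` of the fixed curve `y² = x³ − x` have
  `Δ = 64 u¹²` and one and the same conductor (isomorphic over `ℚ`, `conductorNorm_smul_rat`), so no
  `C` works already at `ε = 1`;
* `stubSzpiroMinimalModel_iff_without_isElliptic` — `IsElliptic` is NOT load-bearing: a singular
  `W₀` has `Δ = 0`, so with `C ≥ 0` (w.l.o.g.) it satisfies the inequality for free.

(The stub's `ε` is load-bearing too: `stubSzpiroMinimalModel_false_without_eps` in the sibling
`Negative/Strengthenings.lean`.)
-/

set_option linter.dupNamespace false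

noncomputable section

open Literature.NumberTheory.DiophantineGeometry Literature.NumberTheory.EllipticCurves
open IsDedekindDomain WeierstrassCurve

namespace Summit.ABC.ABC.Theorems.BalancedFreySzpiro.Negative

/-- `Δ(y² = x³ − u⁴x) = 64 u¹²` over `ℤ`. [folklore] -/
theorem scaledModel_Δ (u : ℤ) : (⟨0, 0, 0, -u ^ 4, 0⟩ : WeierstrassCurve ℤ).Δ = 64 * u ^ 12 := by
  simp only [WeierstrassCurve.Δ, WeierstrassCurve.b₂, WeierstrassCurve.b₄, WeierstrassCurve.b₆,
    WeierstrassCurve.b₈]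
  ring

/-- Over `ℚ`, `y² = x³ − u⁴x` is the variable change `(x, y) ↦ (u²x, u³y)` (`u⁻¹` as the unit) of
`y² = x³ − x`. [folklore] -/
theorem baseChange_scaledModel (u : ℕ) (hu : u ≠ 0) :
    (⟨0, 0, 0, -(u : ℤ) ^ 4, 0⟩ : WeierstrassCurve ℤ).baseChange ℚ =
      (⟨Units.mk0 ((u : ℚ)⁻¹) (by positivity), 0, 0, 0⟩ : VariableChange ℚ) •
        (⟨0, 0, 0, -1, 0⟩ : WeierstrassCurve ℤ).baseChange ℚ := by
  ext <;> simp [WeierstrassCurve.baseChange, WeierstrassCurve.map, variableChange_a₁,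
    variableChange_a₂, variableChange_a₃, variableChange_a₄, variableChange_a₆]

/-- **Minimality is load-bearing for the hard stub (`stub_szpiroMinimalModel_false_without_minimality`
shape):** with `∀ v, IsMinimalAt v` deleted, the statement fails at `ε = 1`: the integral models
`W_u : y² = x³ − u⁴x` are all `ℚ`-isomorphic to `y² = x³ − x`, so `N(W_u) = N₁` is constant
(`conductorNorm_smul_rat`) while `|Δ(W_u)| = 64 u¹² → ∞`. [folklore] -/
theorem stubSzpiroMinimalModel_false_without_minimality :
    ¬ ∀ ε : ℝ, 0 < ε → ∃ C : ℝ, ∀ W₀ : WeierstrassCurve ℤ, (W₀.baseChange ℚ).IsElliptic →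
        (|W₀.Δ| : ℝ) ≤ C * (((W₀.baseChange ℚ).conductorNorm ℤ : ℕ) : ℝ) ^ (6 + ε) := by
  intro h
  obtain ⟨C, hC⟩ := h 1 one_pos
  set W₁ : WeierstrassCurve ℤ := ⟨0, 0, 0, -1, 0⟩ with hW₁
  have hE₁ : (W₁.baseChange ℚ).IsElliptic := by
    rw [WeierstrassCurve.isElliptic_iff]
    show IsUnit ((W₁.map (algebraMap ℤ ℚ)).Δ)
    rw [WeierstrassCurve.map_Δ]
    have : W₁.Δ = 64 := by
      rw [hW₁]; simp only [WeierstrassCurve.Δ, WeierstrassCurve.b₂, WeierstrassCurve.b₄,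
        WeierstrassCurve.b₆, WeierstrassCurve.b₈]; norm_num
    rw [this]; norm_num
  set N₁ : ℝ := (((W₁.baseChange ℚ).conductorNorm ℤ : ℕ) : ℝ) with hN₁
  obtain ⟨u, hu⟩ := exists_nat_gt (C * N₁ ^ (7 : ℕ))
  set u' : ℕ := u + 1 with hu'
  have hu'0 : u' ≠ 0 := by omega
  set Wu : WeierstrassCurve ℤ := ⟨0, 0, 0, -(u' : ℤ) ^ 4, 0⟩ with hWu
  have hbc := baseChange_scaledModel u' hu'0
  haveI : (W₁.baseChange ℚ).IsElliptic := hE₁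
  have hEu : (Wu.baseChange ℚ).IsElliptic := by
    rw [hWu, hbc]; infer_instance
  have hNu : (Wu.baseChange ℚ).conductorNorm ℤ = (W₁.baseChange ℚ).conductorNorm ℤ := by
    rw [hWu, hbc, conductorNorm_smul_rat]
  have key := hC Wu hEu
  rw [hNu, ← hN₁, show (6 : ℝ) + 1 = ((7 : ℕ) : ℝ) by norm_num, Real.rpow_natCast] at key
  have hΔ : Wu.Δ = 64 * (u' : ℤ) ^ 12 := by rw [hWu]; exact scaledModel_Δ _
  rw [hΔ] at key
  push_cast at key
  rw [abs_of_nonneg (by positivity)] at key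
  have h1 : (u : ℝ) < (u' : ℝ) := by rw [hu']; push_cast; linarith
  have hu0 : (0 : ℝ) ≤ u := Nat.cast_nonneg u
  have h2 : (u' : ℝ) ≤ (u' : ℝ) ^ 12 := by
    have h1' : (1 : ℝ) ≤ u' := by rw [hu']; push_cast; linarith
    calc (u' : ℝ) = (u' : ℝ) ^ 1 := (pow_one _).symm
      _ ≤ (u' : ℝ) ^ 12 := pow_le_pow_right₀ h1' (by norm_num)
  linarith

/-- **`IsElliptic` is NOT load-bearing for the hard stub:** the statement with
`(W₀.baseChange ℚ).IsElliptic` deleted is equivalent to the stub, because a singular `W₀` has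
`Δ = 0 ≤ C · N^(6+ε)` once `C ≥ 0`, and `C` may be enlarged to `max C 0`. [folklore] -/
theorem stubSzpiroMinimalModel_iff_without_isElliptic :
    (∀ ε : ℝ, 0 < ε → ∃ C : ℝ, ∀ W₀ : WeierstrassCurve ℤ, (W₀.baseChange ℚ).IsElliptic →
      (∀ v : HeightOneSpectrum ℤ, (W₀.baseChange ℚ).IsMinimalAt v) →
        (|W₀.Δ| : ℝ) ≤ C * (((W₀.baseChange ℚ).conductorNorm ℤ : ℕ) : ℝ) ^ (6 + ε)) ↔
    (∀ ε : ℝ, 0 < ε → ∃ C : ℝ, ∀ W₀ : WeierstrassCurve ℤ,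
      (∀ v : HeightOneSpectrum ℤ, (W₀.baseChange ℚ).IsMinimalAt v) →
        (|W₀.Δ| : ℝ) ≤ C * (((W₀.baseChange ℚ).conductorNorm ℤ : ℕ) : ℝ) ^ (6 + ε)) := by
  constructor
  · intro h ε hε
    obtain ⟨C, hC⟩ := h ε hε
    refine ⟨max C 0, fun W₀ hmin => ?_⟩
    by_cases hE : (W₀.baseChange ℚ).IsElliptic
    · exact (hC W₀ hE hmin).trans (mul_le_mul_of_nonneg_right (le_max_left _ _) (by positivity))
    · have hΔ : W₀.Δ = 0 := by
        by_contra hne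
        apply hE
        rw [WeierstrassCurve.isElliptic_iff]
        show IsUnit ((W₀.map (algebraMap ℤ ℚ)).Δ)
        rw [WeierstrassCurve.map_Δ]
        exact isUnit_iff_ne_zero.mpr (by simpa using hne)
      rw [hΔ]; push_cast; rw [abs_zero]
      exact mul_nonneg (le_max_right _ _) (by positivity)
  · intro h ε hε
    obtain ⟨C, hC⟩ := h ε hε
    exact ⟨C, fun W₀ _ hmin => hC W₀ hmin⟩

end Summit.ABC.ABC.Theorems.BalancedFreySzpiro.Negative

end
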